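import Mathlib.MeasureTheory.Measure.Portmanteau
import Summits.CriticalPhenomena.SAWScalingLimit.Theses.SAWCompassLattice
import Literature.Probability.RandomPlanarGeometry.SLEConvergenceCriterion

/-!
# Subsequential limits of GM's `π/2` Yang–Baxter walk are chordal (crux `CompassSLE`,
# stmt-CriticalPhenomena-6965, line `registered`/`birth`, skeleton v2 — the SOFT half of stub I2)

For a Dobrushin domain `(D; a, b)`, a port endpoint approximation `(a_δ, b_δ)` at `Θ ≡ π/2` and a
probability measure `ν` on `CurveClass ℂ` which is the weak limit, along meshes `s_n → 0⁺`, of the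
laws of the drawn walks `γ.curve (π/2) (s n)` under `ybLaw (π/2) D (s n) 1 (a (s n)) (b (s n))`:
`ν`-almost every curve class starts at `a`, ends at `b` and has its range in `closure D`.

Lattice inputs: the drawn walk starts at `δ · planeMidpoint (a δ) → a` (`YBWalk.path_apply_zero`,
`IsYBEndpointApprox.tendsto_fst`), ends at `δ · planeMidpoint (b δ) → b`, and — once `a δ ≠ b δ`,
which holds for all small `δ` because `a ≠ b` — has an arc, so its range lies in `D`
(`YBWalk.range_path_subset`); the total mass of `ybLaw` is `0` or `1` (inlined; cf. `ybLaw_univ_eq_zero_or_one` of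
`Theorems/SAWCompassLatticeCompassSLEYbAvoidancePassage.lean`), hence `1` eventually along `s_n` (test
the weak convergence against the constant `1`). Passage: Mathlib's portmanteau
inequality for closed sets (`ProbabilityMeasure.limsup_measure_closed_le_of_tendsto`) applied to the
closed events `{dist (source, a) ≤ η} ∩ {dist (target, b) ≤ η} ∩ {range ⊆ closure D}`, then `η → 0`.
-/

noncomputable section

namespace Summit.CriticalPhenomena.SAWScalingLimit.Theorems.SAWCompassLatticeCompassSLE

open MeasureTheory Filter Topology Set Metric
open scoped NNReal ENNReal
open Literature.Probability.RandomPlanarGeometry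
open Literature.Probability.RandomPlanarGeometry.SAW.YangBaxter
open Literature.Probability.LatticeModels (polyline polyline_apply_one)
open Summit.CriticalPhenomena.SAWScalingLimit.Theses

/-- A walk between distinct mid-edges crosses at least two mid-edges: `mids = a :: e :: l`. -/
theorem exists_mids_eq_cons_cons {Δ : Set Face} {a b : MidEdge} (γ : YBWalk Δ a b) (hab : a ≠ b) :
    ∃ (e : MidEdge) (l : List MidEdge), γ.mids = a :: e :: l := by
  have hh := γ.head_eq
  have hl := γ.getLast_eq
  rcases hm : γ.mids with _ | ⟨e₀, _ | ⟨e, l⟩⟩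
  · simp [hm] at hh
  · simp only [hm, List.head?_cons, Option.some.injEq, List.getLast?_singleton] at hh hl
    exact absurd (hh.symm.trans hl) hab
  · simp only [hm, List.head?_cons, Option.some.injEq] at hh
    subst hh
    exact ⟨e, l, rfl⟩

/-- The drawn walk ends at the rescaled midpoint of `b`. -/
theorem path_apply_one {Θ : ℤ → ℝ} {Ω : Set ℂ} {δ : ℝ} {a b : MidEdge}
    (γ : YangBaxterSAW Θ Ω δ a b) : γ.path Θ δ 1 = (δ : ℂ) * planeMidpoint Θ b := by
  have hl := γ.getLast_eq
  unfold YBWalk.path YBWalk.points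
  generalize hm : γ.mids = l at hl
  rcases l with _ | ⟨e, l⟩
  · simp at hl
  · rw [List.map_cons, polyline_apply_one]
    have hb : (e :: l).getLast (List.cons_ne_nil e l) = b := by
      rw [List.getLast?_eq_some_getLast (List.cons_ne_nil e l)] at hl
      exact Option.some.inj hl
    have key : ∀ (l : List MidEdge) (e : MidEdge), (e :: l).getLast (List.cons_ne_nil e l) = b →
        ((δ : ℂ) * planeMidpoint Θ e :: l.map fun e => (δ : ℂ) * planeMidpoint Θ e).getLast
          (List.cons_ne_nil _ _) = (δ : ℂ) * planeMidpoint Θ b := by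
      intro l
      induction l with
      | nil =>
        intro e h
        rw [List.getLast_singleton] at h
        rw [List.map_nil, List.getLast_singleton, h]
      | cons e' l ih =>
        intro e h
        rw [List.getLast_cons_cons] at h
        rw [List.map_cons, List.getLast_cons_cons]
        exact ih e' h
    exact key l e hb

/-- Once `a ≠ b`, a walk from `a` to `b` has an arc, so it is drawn inside `Ω`. -/
theorem range_path_subset_of_ne {Θ : ℤ → ℝ} {Ω : Set ℂ} {δ : ℝ} {a b : MidEdge}
    (γ : YangBaxterSAW Θ Ω δ a b) (hab : a ≠ b) : Set.range (γ.path Θ δ) ⊆ Ω := by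
  refine YBWalk.range_path_subset γ ?_
  obtain ⟨e, l, hm⟩ := exists_mids_eq_cons_cons γ hab
  simp [YBWalk.arcs, arcsOf, hm]

/-- **Subsequential limits of GM's critical `π/2` Yang–Baxter walk are chordal**: `ν`-a.e. curve
class runs from `a = D.pt 0` to `b = D.pt 1` inside `closure D` (the soft half of stub I2 of the
skeleton `Cruxes/CompassSLE/Lines/birth.lean`; registered stub `stub_ybSubseqLimitChordal`). -/
theorem stub_ybSubseqLimitChordal :
    ∀ (D : DobrushinDomain) (a b : ℝ → MidEdge),
      IsYBEndpointApprox (fun (_ : ℤ) => Real.pi / 2) D a b →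
      ∀ (s : ℕ → ℝ) (ν : Measure (CurveClass ℂ)), Tendsto s atTop (𝓝[>] (0 : ℝ)) →
        IsProbabilityMeasure ν →
        (∀ f : BoundedContinuousFunction (CurveClass ℂ) ℝ,
          Tendsto (fun n => ∫ γ, f (γ.curve (fun (_ : ℤ) => Real.pi / 2) (s n))
              ∂(ybLaw (fun (_ : ℤ) => Real.pi / 2) D.carrier (s n) 1 (a (s n)) (b (s n))))
            atTop (𝓝 (∫ x, f x ∂ν))) →
        ∀ᵐ γ ∂ν, γ.source = D.pt 0 ∧ γ.target = D.pt 1 ∧ γ.range ⊆ closure D.carrier := by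
  intro D a b hab s ν hs hν hlim
  classical
  set Θ : ℤ → ℝ := fun _ => Real.pi / 2 with hΘ
  -- the pushed-forward laws along `s`
  set P : ℕ → Measure (CurveClass ℂ) := fun n =>
    (ybLaw Θ D.carrier (s n) 1 (a (s n)) (b (s n))).map (fun γ => γ.curve Θ (s n)) with hP
  have hmeas : ∀ n, Measurable
      (fun γ : YangBaxterSAW Θ D.carrier (s n) (a (s n)) (b (s n)) => γ.curve Θ (s n)) :=
    fun n => YBWalk.measurable_of_top _
  have hweakP : ∀ f : BoundedContinuousFunction (CurveClass ℂ) ℝ,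
      Tendsto (fun n => ∫ x, f x ∂(P n)) atTop (𝓝 (∫ x, f x ∂ν)) := fun f => by
    have hint : ∀ n, ∫ x, f x ∂(P n) =
        ∫ γ, f (γ.curve Θ (s n)) ∂(ybLaw Θ D.carrier (s n) 1 (a (s n)) (b (s n))) := fun n =>
      integral_map (hmeas n).aemeasurable f.continuous.aestronglyMeasurable
    simp only [hint]
    exact hlim f
  -- masses `0` or `1`, hence `1` eventually
  have hmass01 : ∀ n, P n univ = 0 ∨ P n univ = 1 := fun n => by
    simp only [hP]
    rw [Measure.map_apply (hmeas n) MeasurableSet.univ, preimage_univ, ybLaw, Measure.smul_apply,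
      smul_eq_mul]
    -- the total mass of GM's law is `0` (junk) or `1` (cf. `ybLaw_univ_eq_zero_or_one` of the I3 file)
    by_cases h0 : ybWeight Θ D.carrier (s n) 1 (a (s n)) (b (s n)) univ = 0
    · left
      rw [h0, mul_zero]
    by_cases ht : ybWeight Θ D.carrier (s n) 1 (a (s n)) (b (s n)) univ = ∞
    · left
      rw [ht, ENNReal.inv_top, zero_mul]
    · right
      exact ENNReal.inv_mul_cancel h0 ht
  have hevP : ∀ᶠ n in atTop, IsProbabilityMeasure (P n) := by
    have h := hweakP (BoundedContinuousFunction.const (CurveClass ℂ) (1 : ℝ))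
    simp only [BoundedContinuousFunction.const_apply, integral_const, smul_eq_mul, mul_one,
      probReal_univ] at h
    have hev : ∀ᶠ n in atTop, (1 / 2 : ℝ) < (P n).real univ := h.eventually (lt_mem_nhds (by norm_num))
    filter_upwards [hev] with n hn
    rcases hmass01 n with h0 | h1
    · exfalso
      rw [measureReal_def, h0, ENNReal.toReal_zero] at hn
      linarith
    · exact ⟨h1⟩
  -- portmanteau for closed sets along `s`
  let Q : ℕ → ProbabilityMeasure (CurveClass ℂ) := fun n =>
    if h : IsProbabilityMeasure (P n) then ⟨P n, h⟩ else ⟨ν, hν⟩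
  have hQP : ∀ᶠ n in atTop, (Q n : Measure (CurveClass ℂ)) = P n := by
    filter_upwards [hevP] with n hn
    simp only [Q, dif_pos hn, ProbabilityMeasure.coe_mk]
  have hQlim : Tendsto Q atTop (𝓝 (⟨ν, hν⟩ : ProbabilityMeasure (CurveClass ℂ))) := by
    rw [ProbabilityMeasure.tendsto_iff_forall_integral_tendsto]
    intro f
    refine (hweakP f).congr' ?_
    filter_upwards [hQP] with n hn
    rw [hn]
  have hclosed : ∀ C : Set (CurveClass ℂ), IsClosed C → (∀ᶠ n in atTop, P n C = 1) → ν C = 1 := by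
    intro C hC hPC
    have h := ProbabilityMeasure.limsup_measure_closed_le_of_tendsto hQlim hC
    have heq : (fun n => (Q n : Measure (CurveClass ℂ)) C) =ᶠ[atTop] fun _ => (1 : ℝ≥0∞) := by
      filter_upwards [hQP, hPC] with n hn hn'
      rw [hn, hn']
    rw [limsup_congr heq, limsup_const] at h
    exact le_antisymm prob_le_one h
  -- the lattice curves: eventually from near `a` to near `b` inside `D`
  have hab' : D.pt 0 ≠ D.pt 1 := fun h => absurd (D.pt_injective h) (by decide)
  have hfst : Tendsto (fun n => ((s n : ℝ) : ℂ) * planeMidpoint Θ (a (s n))) atTop (𝓝 (D.pt 0)) :=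
    hab.tendsto_fst.comp hs
  have hsnd : Tendsto (fun n => ((s n : ℝ) : ℂ) * planeMidpoint Θ (b (s n))) atTop (𝓝 (D.pt 1)) :=
    hab.tendsto_snd.comp hs
  have hne : ∀ᶠ n in atTop, a (s n) ≠ b (s n) := by
    have hd : 0 < dist (D.pt 0) (D.pt 1) / 2 := half_pos (dist_pos.2 hab')
    filter_upwards [hfst.eventually (ball_mem_nhds _ hd), hsnd.eventually (ball_mem_nhds _ hd)]
      with n ha hb h
    rw [h] at ha
    have := dist_triangle_left (D.pt 0) (D.pt 1) (((s n : ℝ) : ℂ) * planeMidpoint Θ (b (s n)))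
    linarith
  -- the closed events
  set C : ℝ → Set (CurveClass ℂ) := fun η =>
    {γ | dist γ.source (D.pt 0) ≤ η} ∩ {γ | dist γ.target (D.pt 1) ≤ η} ∩
      CurveClass.rangeSubset (closure D.carrier) with hC
  have hCcl : ∀ η, IsClosed (C η) := fun η =>
    ((isClosed_le (CurveClass.continuous_source.dist continuous_const) continuous_const).inter
      (isClosed_le (CurveClass.continuous_target.dist continuous_const) continuous_const)).inter
      (CurveClass.isClosed_rangeSubset isClosed_closure)
  have hPC : ∀ η : ℝ, 0 < η → ∀ᶠ n in atTop, P n (C η) = 1 := by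
    intro η hη
    filter_upwards [hevP, hne, hfst.eventually (closedBall_mem_nhds _ hη),
      hsnd.eventually (closedBall_mem_nhds _ hη)] with n hn hne' ha hb
    haveI := hn
    have hall : ∀ γ : YangBaxterSAW Θ D.carrier (s n) (a (s n)) (b (s n)), γ.curve Θ (s n) ∈ C η := by
      intro γ
      refine ⟨⟨?_, ?_⟩, ?_⟩
      · show dist (CurveClass.mk ⟨γ.path Θ (s n)⟩).source (D.pt 0) ≤ η
        rw [CurveClass.source_mk]
        show dist (γ.path Θ (s n) 0) (D.pt 0) ≤ η
        rw [YBWalk.path_apply_zero]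
        exact mem_closedBall.1 ha
      · show dist (CurveClass.mk ⟨γ.path Θ (s n)⟩).target (D.pt 1) ≤ η
        rw [CurveClass.target_mk]
        show dist (γ.path Θ (s n) 1) (D.pt 1) ≤ η
        rw [path_apply_one]
        exact mem_closedBall.1 hb
      · show (CurveClass.mk ⟨γ.path Θ (s n)⟩).range ⊆ closure D.carrier
        rw [CurveClass.range_mk]
        exact (range_path_subset_of_ne γ hne').trans subset_closure
    have : P n (C η) = P n univ := by
      simp only [hP]
      rw [Measure.map_apply (hmeas n) (hCcl η).measurableSet,
        Measure.map_apply (hmeas n) MeasurableSet.univ]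
      congr 1
      ext γ
      simp only [mem_preimage, preimage_univ, mem_univ, iff_true]
      exact hall γ
    rw [this]
    exact measure_univ
  have hνC : ∀ m : ℕ, ν (C (1 / ((m : ℝ) + 1))) = 1 := fun m =>
    hclosed _ (hCcl _) (hPC _ Nat.one_div_pos_of_nat)
  -- conclusion: intersect over `η = 1/(m+1)`
  have hae : ∀ᵐ γ ∂ν, ∀ m : ℕ, γ ∈ C (1 / ((m : ℝ) + 1)) := by
    rw [ae_all_iff]
    intro m
    have h1 : ν (C (1 / ((m : ℝ) + 1)))ᶜ = 0 :=
      (prob_compl_eq_zero_iff (hCcl _).measurableSet).2 (hνC m)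
    rw [ae_iff]
    exact measure_mono_null (fun γ hγ => hγ) h1
  filter_upwards [hae] with γ hγ
  have hsmall : ∀ {x y : ℂ}, (∀ m : ℕ, dist x y ≤ 1 / ((m : ℝ) + 1)) → x = y := by
    intro x y h
    by_contra hxy
    obtain ⟨m, hm⟩ := exists_nat_one_div_lt (dist_pos.2 hxy)
    exact absurd (h m) (not_le.2 hm)
  refine ⟨hsmall fun m => (hγ m).1.1, hsmall fun m => (hγ m).1.2, (hγ 0).2⟩

end Summit.CriticalPhenomena.SAWScalingLimit.Theorems.SAWCompassLatticeCompassSLE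

end
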